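import Summits.BirchSwinnertonDyer.Rank1Residual.X12.InertCoreEveryCurve
import Literature.NumberTheory.EllipticCurves.ManinConstantModularDegree
import HarnessLib

/-!
# X12 inert-bad core at `p ≥ 5`, ANY conductor: the upper half of `BSD(E,p)` for EVERY curve from
# ONE class integer — a modular degree prime to `p` (Česnavičius–Neururer–Saha 2024 Thm. 1.2) —
# with NO optimality and NO Manin table

HONEST FRAMING (cell `b2b-bsdres`, run/shared/lean/b2b/bsd-rank1-residual/, verbatim in every
file): the goal of the cell is to DELETE the COMBINATION-SHAPED residual classes of the
Birch–Swinnerton-Dyer formula for ALL analytic-rank `≤ 1` elliptic curves over `ℚ` — "full BSD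
formula for every rank `≤ 1` curve in class `C`" assembled STRICTLY from published theorems — so
that the rank-`≤ 1` remainder becomes exactly the CONSTRUCTION-SHAPED classes, which are TYPED
(missing-input `Prop`s), NOT attempted. This is not "finishing BSD". Class X12 is
CONSTRUCTION-SHAPED and stays so; research-route record of the unit `b2b-bsdres-x1b` (X12 prover
owner, gen 20); no claim beyond the stated class; nothing here is booked.

Third companion of `InertCoreEveryCurve.lean` (the inert core at `p ≥ 11`, every curve, ANY
conductor: Edixhoven 1991 Thm. 3 + Deuring discharge the Manin datum of the strong member) and
`InertCoreEveryCurveCremona.lean` (`p ≥ 5`, conductor `≤ 130000`: Cremona's theorem, ARS06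
Thm. 2.6, for the strong member). What those two leave: the cells at `p ∈ {5, 7}` with conductor
`> 130000` (x1b gen 19 census: 258 of the 995 CM-inert additive `p ≥ 5`, `r = 1` cells to
`5·10⁵`), where the Manin datum `p ∤ c(D)` of gen 9's upper half
(`missingUpperBoundAt_of_classX12_of_not_cmRamified'`) so far rests on Cremona's database entry
for the OPTIMAL curve (`opt_man`; 19 of the 258 with optimality undetermined). HERE the datum is
discharged by the PUBLISHED theorem of Česnavičius–Neururer–Saha (JEMS 26 (2024) Thm. 1.2, binder
`hCNS : cesnaviciusNeururerSaha_padicVal_maninConstant_le_modularDegree`: `val_p(c_φ) ≤ val_p(deg φ)`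
at every `p ≥ 5` for EVERY parametrisation `φ : X₀(N) ↠ E`, optimal or not) from ONE exact class
integer: a modular degree prime to `p` of SOME member `W' ∼ W` of the class (hypothesis `hdeg`;
Cremona's `alldegphi` — modular symbols — lists the degree of every member). NO optimality, NO
identification of the strong curve, NO Manin table, ANY conductor, every `p ≥ 5`: the half is
proved on `W'` (gen 9) and moved to `W` by Cassels (`missingUpperBoundAt_of_isIsogenous`, gen 19),
the class predicates moving by `CMIsogenyInvariance`. Then, as in the companions: `BSD(E,p) ⟺
MissingLowerBoundAt`, `X12.MissingInputAt ⇐ lower half`, and route T-KR (`BSD(E,p)` from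
`r_an = 1` + a certified `p`-adic unit `#Ш_an`). §3 does the same at every ODD bad `p ∤ d_K`,
`p = 3` INCLUDED (gen 12's sub-family, `K ≠ ℚ(√−3)`; there the Tamagawa datum `3 ∤ ∏c_ℓ` of the
member and the printed `p = 3` exceptional clause — void whenever `2 ∣ N`, so for every `j = 1728`
curve — are hypotheses). Census reach (x1b gen 20 `DEG-LEVER-995.tsv` / `DEG-LEVER-P3-154.tsv`,
Cremona `alldegphi` curve 1): `p ∤ deg` at 584 of the 995 `p ≥ 5` cells — at 129 of the 258 cells
`p ∈ {5,7}`, `N > 130000` (10 of the 19 optimality-undetermined ones) —, and at 41 of the 154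
`p = 3` inert-bad cells (exceptional clause void at 154/154). Nothing is booked; no label moves; the
lower half (STEP L at an additive potentially supersingular prime) is untouched.

References: K. Česnavičius, M. Neururer, A. Saha, JEMS 26 (2024) 573–637, Thm. 1.2; A. Matar,
J. Nekovář, JTNB 31 (2019) Thm. 0.3, §0.11; J. S. Milne, *ADT* I.7.3 (Cassels); HOME
`b2b-bsdres-x1b/X12-ROUTE.md` §24.
-/

set_option autoImplicit false

noncomputable section

open scoped Classical NumberField

open WeierstrassCurve NumberField IsDedekindDomain Literature.NumberTheory.EllipticCurves
  Literature.NumberTheory.EllipticCurves.ModularForms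
  Literature.NumberTheory.EllipticCurves.Rank1Residual
  Literature.NumberTheory.EllipticCurves.Rank1Residual.Typed
  Literature.NumberTheory.Automorphic
  Literature.NumberTheory.EllipticCurves.Wuthrich2014

namespace Summit.BirchSwinnertonDyer.Rank1Residual.X12

/-! ### §1 The Manin datum from the curve's OWN modular degree -/

/-- **X12, `p ≥ 5`, `p ∤ d_K`: the upper half of `BSD(E,p)` from the curve's own modular degree.**
For a globally minimal `W/ℚ` with `ClassX12 W p`, `5 ≤ p`, `¬ CMRamified W p` and a
parametrisation datum `D` at the conductor level whose modular degree is prime to `p`: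
`MissingUpperBoundAt W p` — gen 9's `missingUpperBoundAt_of_classX12_of_not_cmRamified'` with its
Manin datum `p ∤ c(D)` DISCHARGED by Česnavičius–Neururer–Saha Thm. 1.2 (`hCNS`; `D` need not be
optimal). [cite: CesnaviciusNeururerSaha2023, Thm. 1.2] [cite: MatarNekovar2019, Thm. 0.3 and §0.11] -/
theorem missingUpperBoundAt_of_classX12_of_not_cmRamified_of_not_dvd_modularDegree'
    (hGZ : ∀ (N : ℕ) [NeZero N] (W : WeierstrassCurve ℚ) (K : Type) [Field K] [NumberField K],
      gross_zagier N W K)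
    (hKo : ∀ (N : ℕ) [NeZero N] (W : WeierstrassCurve ℚ) (K : Type) [Field K] [NumberField K],
      kolyvagin N W K)
    (hMN : ∀ (N : ℕ) [NeZero N] (W : WeierstrassCurve ℚ) (K : Type) [Field K] [NumberField K],
      MatarNekovar2019.thm03_padicValNat_card_sha_le_of_irreducible N W K)
    (hGZK : rank_eq_analyticRank_of_analyticRank_le_one) (hmod : hasEntireLFunction_rat)
    (hnf : exists_isNewformOf) (hFH : friedbergHoffstein_exists_heegnerField_split_twist_ne_zero)
    (hCM8 : bsdTriple_of_hasCM_of_L_one_ne_zero)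
    (hCNS : cesnaviciusNeururerSaha_padicVal_maninConstant_le_modularDegree)
    (W : WeierstrassCurve ℚ) [W.IsElliptic] [W.IsGloballyMinimal] (p : ℕ) [Fact p.Prime]
    [NeZero (W.conductorNorm ℤ)]
    (hX : ClassX12 W p) (hp5 : 5 ≤ p) (hnr : ¬ CMRamified W p)
    (D : ModularParametrizationData W (W.conductorNorm ℤ)) (hdeg : ¬ p ∣ D.modularDegree) :
    MissingUpperBoundAt W p :=
  missingUpperBoundAt_of_classX12_of_not_cmRamified' hGZ hKo hMN hGZK hmod hnf hFH hCM8 W p hX hp5 hnr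
    D (not_dvd_maninConstant_of_not_dvd_modularDegree hCNS W D Fact.out hp5 hdeg)

/-! ### §2 The core at `p ≥ 5`, ANY conductor, EVERY curve: the datum on ANY member of the class -/

/-- **X12 INERT-BAD CORE (and the split-bad corner), `p ≥ 5`, ANY conductor, EVERY CURVE: the
upper half of `BSD(E,p)` from published facts + ONE class integer.** For EVERY globally minimal
`W/ℚ` with `ClassX12 W p`, `5 ≤ p`, `p ∤ d_K`, and SOME globally minimal `W' ∼ W` (any member of
the `ℚ`-isogeny class, optimal or not) carrying a parametrisation datum `D'` at the conductor level
with `p ∤ deg(D')`: `MissingUpperBoundAt W p`. Česnavičius–Neururer–Saha (`hCNS`) gives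
`p ∤ c(D')`, gen 9's half holds for `W'` (class predicates by `CMIsogenyInvariance`), and Cassels
(`hCassels`) moves it to `W`. No optimality, no Manin table, no identification of the strong curve.
[cite: CesnaviciusNeururerSaha2023, Thm. 1.2] [cite: MatarNekovar2019, Thm. 0.3 and §0.11]
[cite: MilneADT2006, Thm. I.7.3 and Remark I.7.4] -/
theorem missingUpperBoundAt_of_classX12_of_not_cmRamified_of_not_dvd_modularDegree
    (hGZ : ∀ (N : ℕ) [NeZero N] (W : WeierstrassCurve ℚ) (K : Type) [Field K] [NumberField K],
      gross_zagier N W K)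
    (hKo : ∀ (N : ℕ) [NeZero N] (W : WeierstrassCurve ℚ) (K : Type) [Field K] [NumberField K],
      kolyvagin N W K)
    (hMN : ∀ (N : ℕ) [NeZero N] (W : WeierstrassCurve ℚ) (K : Type) [Field K] [NumberField K],
      MatarNekovar2019.thm03_padicValNat_card_sha_le_of_irreducible N W K)
    (hGZK : rank_eq_analyticRank_of_analyticRank_le_one) (hmod : hasEntireLFunction_rat)
    (hnf : exists_isNewformOf) (hFH : friedbergHoffstein_exists_heegnerField_split_twist_ne_zero)
    (hCM8 : bsdTriple_of_hasCM_of_L_one_ne_zero)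
    (hCNS : cesnaviciusNeururerSaha_padicVal_maninConstant_le_modularDegree)
    (hCassels : bsdRHS_eq_of_isIsogenous)
    (W : WeierstrassCurve ℚ) [W.IsElliptic] [W.IsGloballyMinimal] (p : ℕ) [Fact p.Prime]
    (hX : ClassX12 W p) (hp5 : 5 ≤ p) (hnr : ¬ CMRamified W p)
    (hdeg : ∃ (W' : WeierstrassCurve ℚ) (_ : W'.IsElliptic) (_ : W'.IsGloballyMinimal)
      (_ : NeZero (W'.conductorNorm ℤ)) (D' : ModularParametrizationData W' (W'.conductorNorm ℤ)),
      IsIsogenous W W' ∧ ¬ p ∣ D'.modularDegree) :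
    MissingUpperBoundAt W p := by
  obtain ⟨W', hE', hM', hN', D', hiso, hdeg'⟩ := hdeg
  have hX' : ClassX12 W' p := (classX12_iff_of_isIsogenous hiso p).mp hX
  have hnr' : ¬ CMRamified W' p := fun h ↦ hnr ((cmRamified_iff_of_isIsogenous hiso hX.1 p).mpr h)
  have hup' : MissingUpperBoundAt W' p :=
    missingUpperBoundAt_of_classX12_of_not_cmRamified_of_not_dvd_modularDegree' hGZ hKo hMN hGZK hmod
      hnf hFH hCM8 hCNS W' p hX' hp5 hnr' D' hdeg'
  exact missingUpperBoundAt_of_isIsogenous hCassels hiso (hGZK W' (by rw [hX'.2.1])).2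
    (W'.leadingLCoeff_ne_zero_holds (hmod W')) hup'

/-- **`BSD(E,p)` at `p ≥ 5`, any conductor, every curve of an X12 class with `p ∤ d_K` and a
member's modular degree prime to `p`, from the curve's own lower half.**
[cite: CesnaviciusNeururerSaha2023, Thm. 1.2] [cite: MatarNekovar2019, Thm. 0.3 and §0.11] -/
theorem bsdp_of_classX12_of_not_cmRamified_of_not_dvd_modularDegree_of_lower
    (hGZ : ∀ (N : ℕ) [NeZero N] (W : WeierstrassCurve ℚ) (K : Type) [Field K] [NumberField K],
      gross_zagier N W K)
    (hKo : ∀ (N : ℕ) [NeZero N] (W : WeierstrassCurve ℚ) (K : Type) [Field K] [NumberField K],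
      kolyvagin N W K)
    (hMN : ∀ (N : ℕ) [NeZero N] (W : WeierstrassCurve ℚ) (K : Type) [Field K] [NumberField K],
      MatarNekovar2019.thm03_padicValNat_card_sha_le_of_irreducible N W K)
    (hGZK : rank_eq_analyticRank_of_analyticRank_le_one) (hmod : hasEntireLFunction_rat)
    (hnf : exists_isNewformOf) (hFH : friedbergHoffstein_exists_heegnerField_split_twist_ne_zero)
    (hCM8 : bsdTriple_of_hasCM_of_L_one_ne_zero)
    (hCNS : cesnaviciusNeururerSaha_padicVal_maninConstant_le_modularDegree)
    (hCassels : bsdRHS_eq_of_isIsogenous)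
    (W : WeierstrassCurve ℚ) [W.IsElliptic] [W.IsGloballyMinimal] (p : ℕ) [Fact p.Prime]
    (hX : ClassX12 W p) (hp5 : 5 ≤ p) (hnr : ¬ CMRamified W p)
    (hdeg : ∃ (W' : WeierstrassCurve ℚ) (_ : W'.IsElliptic) (_ : W'.IsGloballyMinimal)
      (_ : NeZero (W'.conductorNorm ℤ)) (D' : ModularParametrizationData W' (W'.conductorNorm ℤ)),
      IsIsogenous W W' ∧ ¬ p ∣ D'.modularDegree)
    (hlow : MissingLowerBoundAt W p) : BSDp W p :=
  bsdp_of_missingPPartAt W p hGZK (by rw [hX.2.1])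
    (missingPPartAt_of_lower_of_upper W p hlow
      (missingUpperBoundAt_of_classX12_of_not_cmRamified_of_not_dvd_modularDegree hGZ hKo hMN hGZK
        hmod hnf hFH hCM8 hCNS hCassels W p hX hp5 hnr hdeg))

/-- **The typed input `X12.MissingInputAt W p` at `p ≥ 5`, any conductor, follows from the curve's
own lower half** given a member's modular degree prime to `p` (X12 stays CONSTRUCTION-SHAPED).
[cite: CesnaviciusNeururerSaha2023, Thm. 1.2] [cite: MatarNekovar2019, Thm. 0.3 and §0.11] -/
theorem missingInputAt_of_classX12_of_not_cmRamified_of_not_dvd_modularDegree_of_lower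
    (hGZ : ∀ (N : ℕ) [NeZero N] (W : WeierstrassCurve ℚ) (K : Type) [Field K] [NumberField K],
      gross_zagier N W K)
    (hKo : ∀ (N : ℕ) [NeZero N] (W : WeierstrassCurve ℚ) (K : Type) [Field K] [NumberField K],
      kolyvagin N W K)
    (hMN : ∀ (N : ℕ) [NeZero N] (W : WeierstrassCurve ℚ) (K : Type) [Field K] [NumberField K],
      MatarNekovar2019.thm03_padicValNat_card_sha_le_of_irreducible N W K)
    (hGZK : rank_eq_analyticRank_of_analyticRank_le_one) (hmod : hasEntireLFunction_rat)
    (hnf : exists_isNewformOf) (hFH : friedbergHoffstein_exists_heegnerField_split_twist_ne_zero)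
    (hCM8 : bsdTriple_of_hasCM_of_L_one_ne_zero)
    (hCNS : cesnaviciusNeururerSaha_padicVal_maninConstant_le_modularDegree)
    (hCassels : bsdRHS_eq_of_isIsogenous)
    (W : WeierstrassCurve ℚ) [W.IsElliptic] [W.IsGloballyMinimal] (p : ℕ) [Fact p.Prime]
    (hX : ClassX12 W p) (hp5 : 5 ≤ p) (hnr : ¬ CMRamified W p)
    (hdeg : ∃ (W' : WeierstrassCurve ℚ) (_ : W'.IsElliptic) (_ : W'.IsGloballyMinimal)
      (_ : NeZero (W'.conductorNorm ℤ)) (D' : ModularParametrizationData W' (W'.conductorNorm ℤ)),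
      IsIsogenous W W' ∧ ¬ p ∣ D'.modularDegree)
    (hlow : MissingLowerBoundAt W p) : X12.MissingInputAt W p := fun _ ↦
  missingPPartAt_of_lower_of_upper W p hlow
    (missingUpperBoundAt_of_classX12_of_not_cmRamified_of_not_dvd_modularDegree hGZ hKo hMN hGZK hmod
      hnf hFH hCM8 hCNS hCassels W p hX hp5 hnr hdeg)

/-- **`BSD(E,p) ⟺ MissingLowerBoundAt W p` at `p ≥ 5`, any conductor, for every curve of an X12
class with `p ∤ d_K` and a member's modular degree prime to `p`.**
[cite: CesnaviciusNeururerSaha2023, Thm. 1.2] [cite: MatarNekovar2019, Thm. 0.3 and §0.11] -/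
theorem bsdp_iff_missingLowerBoundAt_of_classX12_of_not_cmRamified_of_not_dvd_modularDegree
    (hGZ : ∀ (N : ℕ) [NeZero N] (W : WeierstrassCurve ℚ) (K : Type) [Field K] [NumberField K],
      gross_zagier N W K)
    (hKo : ∀ (N : ℕ) [NeZero N] (W : WeierstrassCurve ℚ) (K : Type) [Field K] [NumberField K],
      kolyvagin N W K)
    (hMN : ∀ (N : ℕ) [NeZero N] (W : WeierstrassCurve ℚ) (K : Type) [Field K] [NumberField K],
      MatarNekovar2019.thm03_padicValNat_card_sha_le_of_irreducible N W K)
    (hGZK : rank_eq_analyticRank_of_analyticRank_le_one) (hmod : hasEntireLFunction_rat)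
    (hnf : exists_isNewformOf) (hFH : friedbergHoffstein_exists_heegnerField_split_twist_ne_zero)
    (hCM8 : bsdTriple_of_hasCM_of_L_one_ne_zero)
    (hCNS : cesnaviciusNeururerSaha_padicVal_maninConstant_le_modularDegree)
    (hCassels : bsdRHS_eq_of_isIsogenous)
    (W : WeierstrassCurve ℚ) [W.IsElliptic] [W.IsGloballyMinimal] (p : ℕ) [Fact p.Prime]
    (hX : ClassX12 W p) (hp5 : 5 ≤ p) (hnr : ¬ CMRamified W p)
    (hdeg : ∃ (W' : WeierstrassCurve ℚ) (_ : W'.IsElliptic) (_ : W'.IsGloballyMinimal)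
      (_ : NeZero (W'.conductorNorm ℤ)) (D' : ModularParametrizationData W' (W'.conductorNorm ℤ)),
      IsIsogenous W W' ∧ ¬ p ∣ D'.modularDegree) :
    BSDp W p ↔ MissingLowerBoundAt W p := by
  refine ⟨fun hb ↦ ?_, fun hlow ↦ ?_⟩
  · haveI : Finite W.sha := (hGZK W (by rw [hX.2.1])).2
    exact (lower_and_upper_of_missingPPartAt W p (missingPPartAt_of_bsdp W p hb)).1
  · exact bsdp_of_classX12_of_not_cmRamified_of_not_dvd_modularDegree_of_lower hGZ hKo hMN hGZK hmod
      hnf hFH hCM8 hCNS hCassels W p hX hp5 hnr hdeg hlow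

/-- **Route T-KR at `p ≥ 5`, ANY conductor, for EVERY curve with `p ∤ d_K`: `BSD(E,p)` from
`r_an = 1`, a certified `p`-adic unit `#Ш(E)_an`, and ONE class integer — a member's modular
degree prime to `p`** (no Manin table, no optimality, no index, no descent).
[cite: CesnaviciusNeururerSaha2023, Thm. 1.2] [cite: MatarNekovar2019, Thm. 0.3 and §0.11] -/
theorem bsdp_of_classX12_of_not_cmRamified_of_not_dvd_modularDegree_of_shaAn_unit
    (hGZ : ∀ (N : ℕ) [NeZero N] (W : WeierstrassCurve ℚ) (K : Type) [Field K] [NumberField K],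
      gross_zagier N W K)
    (hKo : ∀ (N : ℕ) [NeZero N] (W : WeierstrassCurve ℚ) (K : Type) [Field K] [NumberField K],
      kolyvagin N W K)
    (hMN : ∀ (N : ℕ) [NeZero N] (W : WeierstrassCurve ℚ) (K : Type) [Field K] [NumberField K],
      MatarNekovar2019.thm03_padicValNat_card_sha_le_of_irreducible N W K)
    (hGZK : rank_eq_analyticRank_of_analyticRank_le_one) (hmod : hasEntireLFunction_rat)
    (hnf : exists_isNewformOf) (hFH : friedbergHoffstein_exists_heegnerField_split_twist_ne_zero)
    (hCM8 : bsdTriple_of_hasCM_of_L_one_ne_zero)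
    (hCNS : cesnaviciusNeururerSaha_padicVal_maninConstant_le_modularDegree)
    (hCassels : bsdRHS_eq_of_isIsogenous)
    (W : WeierstrassCurve ℚ) [W.IsElliptic] [W.IsGloballyMinimal] (p : ℕ) [Fact p.Prime]
    (hX : ClassX12 W p) (hp5 : 5 ≤ p) (hnr : ¬ CMRamified W p)
    (hdeg : ∃ (W' : WeierstrassCurve ℚ) (_ : W'.IsElliptic) (_ : W'.IsGloballyMinimal)
      (_ : NeZero (W'.conductorNorm ℤ)) (D' : ModularParametrizationData W' (W'.conductorNorm ℤ)),
      IsIsogenous W W' ∧ ¬ p ∣ D'.modularDegree)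
    {q : ℚ} (hq : shaAn W = (q : ℂ)) (hv : padicValRat p q = 0) : BSDp W p :=
  bsdp_of_classX12_of_not_cmRamified_of_not_dvd_modularDegree_of_lower hGZ hKo hMN hGZK hmod hnf hFH
    hCM8 hCNS hCassels W p hX hp5 hnr hdeg (missingLowerBoundAt_of_shaAn_unit hq hv)

/-! ### §3 Every ODD bad prime `p ∤ d_K`, `p = 3` INCLUDED: every curve, degree + Tamagawa data on
ANY member (the `p = 3` inert-bad sub-family of gen 12, `K ≠ ℚ(√−3)`) -/

/-- **X12 at every ODD bad prime unramified in the CM field (`p = 3` included), EVERY CURVE: the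
upper half of `BSD(E,p)` from published facts + two table data of ONE member.** For every globally
minimal `W/ℚ` with `ClassX12 W p`, `p ≠ 2`, `p ∣ N` (`¬ Good W p`), `p ∤ d_K`, and SOME globally
minimal member `W' ∼ W` with a datum `D'` at the conductor level such that `p ∤ deg(D')`,
`p ∤ ∏_ℓ c_ℓ(W')` (automatic at `p ≥ 5` for a CM curve; a table datum at `p = 3`) and, at
`p = 3`, `W'` lies outside the printed exceptional clause of Česnavičius–Neururer–Saha (`3³ ∤ N` or
some prime `≡ 2 (mod 3)` divides `N` — void for every `j = 1728` curve since `2 ∣ N`):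
`MissingUpperBoundAt W p`. Gen 12's `missingUpperBoundAt_of_classX12_of_bad_odd` on `W'` with its
Manin datum discharged by `hCNS`, moved to `W` by Cassels.
[cite: CesnaviciusNeururerSaha2023, Thm. 1.2] [cite: MatarNekovar2019, Thm. 0.3 and §0.11]
[cite: MilneADT2006, Thm. I.7.3 and Remark I.7.4] -/
theorem missingUpperBoundAt_of_classX12_of_bad_odd_of_not_dvd_modularDegree
    (hGZ : ∀ (N : ℕ) [NeZero N] (W : WeierstrassCurve ℚ) (K : Type) [Field K] [NumberField K],
      gross_zagier N W K)
    (hKo : ∀ (N : ℕ) [NeZero N] (W : WeierstrassCurve ℚ) (K : Type) [Field K] [NumberField K],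
      kolyvagin N W K)
    (hMN : ∀ (N : ℕ) [NeZero N] (W : WeierstrassCurve ℚ) (K : Type) [Field K] [NumberField K],
      MatarNekovar2019.thm03_padicValNat_card_sha_le_of_irreducible N W K)
    (hGZK : rank_eq_analyticRank_of_analyticRank_le_one) (hmod : hasEntireLFunction_rat)
    (hnf : exists_isNewformOf) (hFH : friedbergHoffstein_exists_heegnerField_split_twist_ne_zero)
    (hCM8 : bsdTriple_of_hasCM_of_L_one_ne_zero)
    (hCNS : cesnaviciusNeururerSaha_padicVal_maninConstant_le_modularDegree)
    (hCassels : bsdRHS_eq_of_isIsogenous)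
    (W : WeierstrassCurve ℚ) [W.IsElliptic] [W.IsGloballyMinimal] (p : ℕ) [Fact p.Prime]
    (hX : ClassX12 W p) (hp2 : p ≠ 2) (hbad : ¬ Good W p) (hnr : ¬ CMRamified W p)
    (hdeg : ∃ (W' : WeierstrassCurve ℚ) (_ : W'.IsElliptic) (_ : W'.IsGloballyMinimal)
      (_ : NeZero (W'.conductorNorm ℤ)) (D' : ModularParametrizationData W' (W'.conductorNorm ℤ)),
      IsIsogenous W W' ∧ ¬ p ∣ D'.modularDegree ∧ ¬ p ∣ W'.tamagawaProduct ∧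
        ¬ (p = 3 ∧ 3 ^ 3 ∣ W'.conductorNorm ℤ ∧
            ∀ q : ℕ, q.Prime → q ∣ W'.conductorNorm ℤ → q % 3 ≠ 2)) :
    MissingUpperBoundAt W p := by
  obtain ⟨W', hE', hM', hN', D', hiso, hdeg', htam', h3'⟩ := hdeg
  have hp : p.Prime := Fact.out
  have hX' : ClassX12 W' p := (classX12_iff_of_isIsogenous hiso p).mp hX
  have hnr' : ¬ CMRamified W' p := fun h ↦ hnr ((cmRamified_iff_of_isIsogenous hiso hX.1 p).mpr h)
  have hbad' : ¬ Good W' p := fun hg ↦ hbad ((hiso.hasGoodReductionAtPrime_iff p).mpr hg)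
  have hc' : ¬ (p : ℤ) ∣ D'.c :=
    not_dvd_maninConstant_of_padicVal_le_of_not_dvd D' hp
      (hCNS W' D' p hp (fun h2 ↦ hp2 h2.1) h3') hdeg'
  have hup' : MissingUpperBoundAt W' p :=
    missingUpperBoundAt_of_classX12_of_bad_odd hGZ hKo hMN hGZK hmod hnf hFH hCM8 W' p hX' hp2 hbad'
      hnr' D' hc' htam'
  exact missingUpperBoundAt_of_isIsogenous hCassels hiso (hGZK W' (by rw [hX'.2.1])).2
    (W'.leadingLCoeff_ne_zero_holds (hmod W')) hup'

/-- **`BSD(E,p) ⟺ MissingLowerBoundAt W p` at every odd bad `p ∤ d_K` (`p = 3` included), every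
curve, given the member data of
`missingUpperBoundAt_of_classX12_of_bad_odd_of_not_dvd_modularDegree`.**
[cite: CesnaviciusNeururerSaha2023, Thm. 1.2] [cite: MatarNekovar2019, Thm. 0.3 and §0.11] -/
theorem bsdp_iff_missingLowerBoundAt_of_classX12_of_bad_odd_of_not_dvd_modularDegree
    (hGZ : ∀ (N : ℕ) [NeZero N] (W : WeierstrassCurve ℚ) (K : Type) [Field K] [NumberField K],
      gross_zagier N W K)
    (hKo : ∀ (N : ℕ) [NeZero N] (W : WeierstrassCurve ℚ) (K : Type) [Field K] [NumberField K],
      kolyvagin N W K)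
    (hMN : ∀ (N : ℕ) [NeZero N] (W : WeierstrassCurve ℚ) (K : Type) [Field K] [NumberField K],
      MatarNekovar2019.thm03_padicValNat_card_sha_le_of_irreducible N W K)
    (hGZK : rank_eq_analyticRank_of_analyticRank_le_one) (hmod : hasEntireLFunction_rat)
    (hnf : exists_isNewformOf) (hFH : friedbergHoffstein_exists_heegnerField_split_twist_ne_zero)
    (hCM8 : bsdTriple_of_hasCM_of_L_one_ne_zero)
    (hCNS : cesnaviciusNeururerSaha_padicVal_maninConstant_le_modularDegree)
    (hCassels : bsdRHS_eq_of_isIsogenous)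
    (W : WeierstrassCurve ℚ) [W.IsElliptic] [W.IsGloballyMinimal] (p : ℕ) [Fact p.Prime]
    (hX : ClassX12 W p) (hp2 : p ≠ 2) (hbad : ¬ Good W p) (hnr : ¬ CMRamified W p)
    (hdeg : ∃ (W' : WeierstrassCurve ℚ) (_ : W'.IsElliptic) (_ : W'.IsGloballyMinimal)
      (_ : NeZero (W'.conductorNorm ℤ)) (D' : ModularParametrizationData W' (W'.conductorNorm ℤ)),
      IsIsogenous W W' ∧ ¬ p ∣ D'.modularDegree ∧ ¬ p ∣ W'.tamagawaProduct ∧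
        ¬ (p = 3 ∧ 3 ^ 3 ∣ W'.conductorNorm ℤ ∧
            ∀ q : ℕ, q.Prime → q ∣ W'.conductorNorm ℤ → q % 3 ≠ 2)) :
    BSDp W p ↔ MissingLowerBoundAt W p := by
  refine ⟨fun hb ↦ ?_, fun hlow ↦ ?_⟩
  · haveI : Finite W.sha := (hGZK W (by rw [hX.2.1])).2
    exact (lower_and_upper_of_missingPPartAt W p (missingPPartAt_of_bsdp W p hb)).1
  · exact bsdp_of_missingPPartAt W p hGZK (by rw [hX.2.1])
      (missingPPartAt_of_lower_of_upper W p hlow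
        (missingUpperBoundAt_of_classX12_of_bad_odd_of_not_dvd_modularDegree hGZ hKo hMN hGZK hmod
          hnf hFH hCM8 hCNS hCassels W p hX hp2 hbad hnr hdeg))

/-- **Route T-KR at every odd bad `p ∤ d_K` (`p = 3` included), EVERY curve: `BSD(E,p)` from
`r_an = 1`, a certified `p`-adic unit `#Ш(E)_an`, and a member's table data (modular degree and
Tamagawa product prime to `p`; at `p = 3` the void exceptional clause).** The `p = 3` tier-D / tier-M
inert-bad cells (Manin datum so far `MANIN-DB@3`) with `3 ∤ deg` are instances.
[cite: CesnaviciusNeururerSaha2023, Thm. 1.2] [cite: MatarNekovar2019, Thm. 0.3 and §0.11] -/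
theorem bsdp_of_classX12_of_bad_odd_of_not_dvd_modularDegree_of_shaAn_unit
    (hGZ : ∀ (N : ℕ) [NeZero N] (W : WeierstrassCurve ℚ) (K : Type) [Field K] [NumberField K],
      gross_zagier N W K)
    (hKo : ∀ (N : ℕ) [NeZero N] (W : WeierstrassCurve ℚ) (K : Type) [Field K] [NumberField K],
      kolyvagin N W K)
    (hMN : ∀ (N : ℕ) [NeZero N] (W : WeierstrassCurve ℚ) (K : Type) [Field K] [NumberField K],
      MatarNekovar2019.thm03_padicValNat_card_sha_le_of_irreducible N W K)
    (hGZK : rank_eq_analyticRank_of_analyticRank_le_one) (hmod : hasEntireLFunction_rat)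
    (hnf : exists_isNewformOf) (hFH : friedbergHoffstein_exists_heegnerField_split_twist_ne_zero)
    (hCM8 : bsdTriple_of_hasCM_of_L_one_ne_zero)
    (hCNS : cesnaviciusNeururerSaha_padicVal_maninConstant_le_modularDegree)
    (hCassels : bsdRHS_eq_of_isIsogenous)
    (W : WeierstrassCurve ℚ) [W.IsElliptic] [W.IsGloballyMinimal] (p : ℕ) [Fact p.Prime]
    (hX : ClassX12 W p) (hp2 : p ≠ 2) (hbad : ¬ Good W p) (hnr : ¬ CMRamified W p)
    (hdeg : ∃ (W' : WeierstrassCurve ℚ) (_ : W'.IsElliptic) (_ : W'.IsGloballyMinimal)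
      (_ : NeZero (W'.conductorNorm ℤ)) (D' : ModularParametrizationData W' (W'.conductorNorm ℤ)),
      IsIsogenous W W' ∧ ¬ p ∣ D'.modularDegree ∧ ¬ p ∣ W'.tamagawaProduct ∧
        ¬ (p = 3 ∧ 3 ^ 3 ∣ W'.conductorNorm ℤ ∧
            ∀ q : ℕ, q.Prime → q ∣ W'.conductorNorm ℤ → q % 3 ≠ 2))
    {q : ℚ} (hq : shaAn W = (q : ℂ)) (hv : padicValRat p q = 0) : BSDp W p :=
  (bsdp_iff_missingLowerBoundAt_of_classX12_of_bad_odd_of_not_dvd_modularDegree hGZ hKo hMN hGZK hmod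
    hnf hFH hCM8 hCNS hCassels W p hX hp2 hbad hnr hdeg).mpr (missingLowerBoundAt_of_shaAn_unit hq hv)

/-! ### §4 The residue as STEP L at the curve's OWN Heegner data — no optimality -/

/-- **`BSD(E,p) ⟺ STEP L at every Friedberg–Hoffstein Heegner datum of the curve's OWN
parametrisation**, for every globally minimal `W` with `ClassX12 W p`, `5 ≤ p`, `p ∤ d_K` and a
datum `D` at the conductor level with `p ∤ deg(D)` (optimal or not): gen 10's
`bsdp_iff_forall_indexLowerBoundAt_of_classX12_of_not_cmRamified` with its Manin datum `p ∤ c(D)`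
discharged by Česnavičius–Neururer–Saha. STEP L = `X11b.IndexLowerBoundAt W p K P`
(`2·ord_p [E(K):ℤP] ≤ ord_p #Ш(E/K) + 2·ord_p ∏c_ℓ`), the typed input shared with class X11b.
[cite: CesnaviciusNeururerSaha2023, Thm. 1.2] [cite: JetchevSkinnerWan2017, §7.4.2 (p. 31)]
[cite: MatarNekovar2019, Thm. 0.3 and §0.11] -/
theorem bsdp_iff_forall_indexLowerBoundAt_of_classX12_of_not_cmRamified_of_not_dvd_modularDegree
    (hGZ : ∀ (N : ℕ) [NeZero N] (W : WeierstrassCurve ℚ) (K : Type) [Field K] [NumberField K],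
      gross_zagier N W K)
    (hKo : ∀ (N : ℕ) [NeZero N] (W : WeierstrassCurve ℚ) (K : Type) [Field K] [NumberField K],
      kolyvagin N W K)
    (hMN : ∀ (N : ℕ) [NeZero N] (W : WeierstrassCurve ℚ) (K : Type) [Field K] [NumberField K],
      MatarNekovar2019.thm03_padicValNat_card_sha_le_of_irreducible N W K)
    (hGZK : rank_eq_analyticRank_of_analyticRank_le_one) (hmod : hasEntireLFunction_rat)
    (hnf : exists_isNewformOf) (hFH : friedbergHoffstein_exists_heegnerField_split_twist_ne_zero)
    (hCM8 : bsdTriple_of_hasCM_of_L_one_ne_zero)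
    (hCNS : cesnaviciusNeururerSaha_padicVal_maninConstant_le_modularDegree)
    (W : WeierstrassCurve ℚ) [W.IsElliptic] [W.IsGloballyMinimal] (p : ℕ) [Fact p.Prime]
    [NeZero (W.conductorNorm ℤ)]
    (hX : ClassX12 W p) (hp5 : 5 ≤ p) (hnr : ¬ CMRamified W p)
    (D : ModularParametrizationData W (W.conductorNorm ℤ)) (hdeg : ¬ p ∣ D.modularDegree) :
    BSDp W p ↔
      ∀ (K : Type) [Field K] [NumberField K]
        (H : HeegnerDatum (W.conductorNorm ℤ) (NumberField.discr K)) (ι : K →+* ℂ)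
        (P : (W.baseChange K).toAffine.Point),
        IsImaginaryQuadratic K → SatisfiesHeegnerHypothesis (W.conductorNorm ℤ) K →
        4 < (NumberField.discr K).natAbs →
        WeierstrassCurve.Affine.Point.map ι.toRatAlgHom P = heegnerPointComplex D H →
        (W.quadraticTwist (NumberField.discr K : ℚ)).entireLFunction 1 ≠ 0 →
        (Finite (W.baseChange K).sha → X11b.IndexLowerBoundAt W p K P) :=
  bsdp_iff_forall_indexLowerBoundAt_of_classX12_of_not_cmRamified hGZ hKo hMN hGZK hmod hnf hFH hCM8
    W p hX hp5 hnr D (not_dvd_maninConstant_of_not_dvd_modularDegree hCNS W D Fact.out hp5 hdeg)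

end Summit.BirchSwinnertonDyer.Rank1Residual.X12

end
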